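import Summits.QuantumFields.BalabanUV.T4Continuum.Spine.NE1p.B7AveragingAbelianSectorRemainder

/-!
# T⁴ programme, spine estimate NE1′ (node O3b/H2) — THE HESSIAN OF BAŁABAN'S REMAINDER AT THE FLAT BACKGROUND VANISHES ON COMMUTING PAIRS:
# the polarization `D²[C_j(1, ins_S ·)(c)](0)(v)(w)` of the second-order term (136) is `0` whenever the inserted values of `v` and `w`
# pairwise commute — in particular the bond-pair blocks `H_{b,b′}(X, Y) = 0` for `XY = YX` (and every single-bond block `H_{b,b}` vanishes)

Cell `pub-balaban-gaps` (YM blitz Y1, track G2), seat `ne1` gen 8 (prover-pub-balaban-gaps-ne1-g8-0); record `HOME/ne/NE1.md` v8 §4 R52.  ADDITIVE —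
imports this seat's `B7AveragingAbelianSectorRemainder` (file 2 of gen 8: `C_j⁽ⁿ⁾(1, B)(c) = 0` on abelian fields) ONLY; through it the p06 lineage's
`B7Eq136SecondOrder` (`CCovIter2_ins_eq`: the slice definition of `C_j⁽²⁾` is the diagonal of the polarization `D²[C_j(U₀, ins_S ·)(c)](0)`;
`snd_fderiv_CCovIter_ins_symm`: the polarization is symmetric — both under that file's Prop. 4∕5 regime, carried here VERBATIM as hypotheses at
`U₀ = 1`), the b07∕r04 lineages' `B7Prop3Flat.insCfg`∕`norm_insCfg_le` (insertion of finitely many bond variables), `B7Prop2Explicit.pdev`∕`AvgClosed`∕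
`C0`∕`c2'`, `B7Prop3Flat.c3`, `B8Ineq130.hol_one` — consumed BY NAME, nothing edited or restated; NO new definition.

PRINT.  [Balaban1985Averaging] (136)–(138) p. 39 («C_k(U₀, A) = C_k^{(2)}(U₀, A) + C_k^{(3)}(U₀, A) + …», «dF(A, δA) = (d/dt)F(A + tδA)|_{t=0}»);
[Balaban1985Variational] (56) p. 286 («C_j^{(2)}(A′, A″) denotes a symmetric bilinear form obtained by polarization from the quadratic form
C^{(2)}(A′)») — as typed in `B7Eq136SecondOrder`.

WHAT THIS FILE PROVES ([folklore] polarization algebra on top of file 2; 0 sorry).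
* §1 (no regime hypotheses): for a finitely supported field `ins_S v` whose inserted values pairwise commute, `C_j⁽ⁿ⁾(1, ins_S v)(c) = 0` for all `n`
  and `C_j⁽²⁾(1, ins_S v)(c) = 0` (`CCovIterN_one_ins_eq_zero`, `CCovIter2_one_ins_eq_zero`) — file 2 with the sup bound `‖v‖`.
* §2 (under `B7Eq136SecondOrder`'s regime at `U₀ = 1`: `L ≥ 2`, an `AvgClosed` structure group, `0 < α₀` with `C₀α₀ ≤ ⅓`, `4α₀ ≤ c₂′`, a
  witness radius `b > 0` with the smallness `hsmall`∕`hc₃`; (52) for `U₀ = 1` is automatic, `pdev 1 = 0`): writing `H = D²[C_j(1, ins_S ·)(c)](0)`,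
  **`H(v)(w) = 0` whenever the values of `v`, of `w`, and of `v` against `w` pairwise commute** (`snd_fderiv_CCovIter_one_ins_eq_zero`: the quadratic
  form `H(u)(u) = 2·C_j⁽²⁾(1, ins_S u)(c)` vanishes at `u = v, w, v + w`, and `H` is symmetric bilinear); in particular **the bond-pair blocks
  `H(Xe_s)(Ye_{s′}) = 0` whenever `XY = YX`** (`snd_fderiv_CCovIter_one_single_eq_zero`), and **EVERY same-bond block vanishes with NO
  commutativity hypothesis** (`snd_fderiv_CCovIter_one_single_same_eq_zero`: `H(Xe_s)(Ye_s) = 0` for all `X, Y` — the single-bond fields `Xe_s`,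
  `Ye_s`, `(X+Y)e_s` have commuting values): the second-order term (136) at the flat background is PURELY CROSS-BOND —
  `C_j⁽²⁾(1, ins_S a)(c) = ½ Σ_s Σ_{s′≠s} H(a_s e_s)(a_{s′} e_{s′})` (`CCovIter2_one_ins_eq_sum_offDiag`) — and each cross-bond block is a
  «zero-Lie-product-preserving» bilinear map.  For `𝔸 = M_N(ℂ)` such maps factor through the commutator, `H(Xe_s)(Ye_{s′}) = Φ_{s,s′}([X, Y])`:
  the «zero Lie product determined» property of `M_N` (Brešar–Grašič–Sánchez Ortega, LAA 430 (2009); M. Brešar, *Zero Product Determined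
  Algebras* (2021), p. 31 and Thm 3.10 ∕ Cor. 3.11) — a LITERATURE pointer, NOT formalised or used here.
CONSEQUENCE FOR THE ROW (NE1.md v8 R52).  «Cross-bond curvature = commutators» (R46 (a), gen 7's `integral_comm_eq_zero` for the CARRIERS) now has its
identity-level kernel form FOR THE PRINTED SECOND-ORDER TERM (136): every Hessian block vanishes on commuting pairs.  Classification UNCHANGED.

HONEST FRAMING.  [folklore] algebra (polarization of a symmetric bilinear form) over the p06 lineage's theorems, whose Prop. 4∕5 regime is carried as
hypotheses and NOT discharged here beyond (52) at `U₀ = 1`; nothing of Bałaban's asserted beyond the SHAPE of (136)–(138)∕[B11] (56) as typed; no density,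
R-operation, slot or background of his run constructed; NE1′ NOT proved; spine 0∕9; (B) 0∕13; binders 0∕6; one fixed finite T⁴ — NOT ℝ⁴, NOT infinite
volume, NOT a mass gap, NOT Clay.  0 sorry.
-/

noncomputable section

open scoped BigOperators Topology
open NormedSpace Finset Filter

namespace Summit.QuantumFields.BalabanUV.T4Continuum.NE1p.B7AveragingAbelianSector

open Literature.MathematicalPhysics.QuantumFieldTheory.Balaban1983to89.B7Prop1Explicit
open Literature.MathematicalPhysics.QuantumFieldTheory.Balaban1983to89.B7Prop2Explicit (pdev AvgClosed C0 c2')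
open Literature.MathematicalPhysics.QuantumFieldTheory.Balaban1983to89.B7Prop3Flat (insCfg norm_insCfg_le c3)
open Literature.MathematicalPhysics.QuantumFieldTheory.Balaban1983to89.B7Prop5GeneralInduction (CCovIter)
open Literature.MathematicalPhysics.QuantumFieldTheory.Balaban1983to89.B7Eq136SecondOrder (CCovIter2 CCovIter2_ins_eq
  snd_fderiv_CCovIter_ins_symm)
open Literature.MathematicalPhysics.QuantumFieldTheory.Balaban1983to89.B7Eq136Series (CCovIterN CCovIterN_def)
open Literature.MathematicalPhysics.QuantumFieldTheory.Balaban1983to89.B8Ineq130 (hol_one)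

variable {d : ℕ} {𝔸 : Type*} [NormedRing 𝔸] [NormedAlgebra ℂ 𝔸] [CompleteSpace 𝔸] {L : ℕ}

/-! ## §1 Finitely supported fields with commuting inserted values -/

omit [NormedAlgebra ℂ 𝔸] [CompleteSpace 𝔸] in
/-- The inserted field `ins_S v` has pairwise commuting values as soon as the inserted values do (off `S` it is `0`). [folklore] -/
theorem commute_insCfg (S : Finset (Site d × Fin d)) {v : S → 𝔸} (hv : ∀ s s', Commute (v s) (v s')) :
    ∀ x κ y μ, Commute (insCfg S v x κ) (insCfg S v y μ) := by
  intro x κ y μ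
  unfold insCfg
  split_ifs
  · exact hv _ _
  · exact Commute.zero_right _
  · exact Commute.zero_left _
  · exact Commute.zero_left _

/-- **`C_j⁽ⁿ⁾(1, ins_S v)(c) = 0` for all `n`** when the inserted values pairwise commute (file 2 with the sup bound `‖v‖`). [cite: Balaban1985Averaging, (136) p.39] -/
theorem CCovIterN_one_ins_eq_zero (hL : 1 ≤ L) (S : Finset (Site d × Fin d)) {v : S → 𝔸}
    (hv : ∀ s s', Commute (v s) (v s')) (j : ℕ) (z : Site d) (κ : Fin d) (n : ℕ) :
    CCovIterN L (1 : Site d → Fin d → 𝔸ˣ) (insCfg S v) j z κ n = 0 :=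
  CCovIterN_one_eq_zero (commute_insCfg S hv) hL (norm_nonneg v) (fun x κ => norm_insCfg_le S v x κ) j z κ n

/-- **`C_j⁽²⁾(1, ins_S v)(c) = 0`** when the inserted values pairwise commute. [cite: Balaban1985Averaging, (136) p.39] -/
theorem CCovIter2_one_ins_eq_zero (hL : 1 ≤ L) (S : Finset (Site d × Fin d)) {v : S → 𝔸}
    (hv : ∀ s s', Commute (v s) (v s')) (j : ℕ) (z : Site d) (κ : Fin d) :
    CCovIter2 L (1 : Site d → Fin d → 𝔸ˣ) (insCfg S v) j z κ = 0 :=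
  CCovIter2_one_eq_zero (commute_insCfg S hv) hL (norm_nonneg v) (fun x κ => norm_insCfg_le S v x κ) j z κ

/-! ## §2 Polarization: the Hessian at the flat background vanishes on commuting pairs -/

section Regime

variable [NormOneClass 𝔸]
variable (L) (hL : 2 ≤ L) {G : Subgroup 𝔸ˣ} (hG : AvgClosed d L G) (k : ℕ) {α₀ : ℝ} (hα : 0 < α₀)
  (hα3 : C0 d * α₀ ≤ 1 / 3) (hα4 : 4 * α₀ ≤ c2' d L) {b : ℝ} (hb : 0 < b)
  (hsmall : Real.exp (4 * (800 * ((d : ℝ) + 1) ^ 2 * ((d : ℝ) + 4)) * α₀)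
    * (1 + 8 * (131072 * ((d : ℝ) + 1) ^ 2) * ((L : ℝ) ^ k * b)) ≤ 2)
  (hc₃ : 4 * ((L : ℝ) ^ k * b) < c3 d L)
  (S : Finset (Site d × Fin d))

omit [NormedAlgebra ℂ 𝔸] [CompleteSpace 𝔸] [NormOneClass 𝔸] in
include hL hα in
/-- (52) at the flat background: `pdev 1 = 0 < α₀L^{−2k}`. [cite: Balaban1985Averaging, (52) p.26] -/
theorem pdev_one_lt : pdev (1 : Site d → Fin d → 𝔸ˣ) < α₀ * (((L : ℝ) ^ k)⁻¹) ^ 2 := by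
  have hpdev : pdev (1 : Site d → Fin d → 𝔸ˣ) = 0 := by unfold pdev; simp [hol_one]
  have hL0 : (0 : ℝ) < L := by exact_mod_cast lt_of_lt_of_le (by norm_num) hL
  rw [hpdev]; positivity

include hL hG hα hα3 hα4 hb hsmall hc₃ in
/-- **POLARIZATION.**  With `H = D²[C_j(1, ins_S ·)(c)](0)` (the symmetric bilinear polarization of `B7Eq136SecondOrder`, [B11] (56)): if the
inserted values of `v`, of `w` and of `v + w` each pairwise commute, then `H(v)(w) = 0` — because `H(u)(u) = 2·C_j⁽²⁾(1, ins_S u)(c) = 0` at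
`u = v, w, v + w` (§1) and `2H(v)(w) = H(v+w)(v+w) − H(v)(v) − H(w)(w)`. [cite: Balaban1985Averaging, (136)–(138) p.39] [cite: Balaban1985Variational, (56) p.286] -/
theorem snd_fderiv_CCovIter_one_ins_eq_zero {j : ℕ} (hj : j ≤ k) (z : Site d) (κ : Fin d) (v w : S → 𝔸)
    (hvv : ∀ s s', Commute (v s) (v s')) (hww : ∀ s s', Commute (w s) (w s'))
    (hvw : ∀ s s', Commute ((v + w) s) ((v + w) s')) :
    fderiv ℂ (fderiv ℂ (fun a : S → 𝔸 => CCovIter L (1 : Site d → Fin d → 𝔸ˣ) (insCfg S a) j z κ)) 0 v w = 0 := by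
  have hL1 : 1 ≤ L := le_trans (by norm_num) hL
  have hU₀ : ∀ (x : Site d) (κ : Fin d), (1 : Site d → Fin d → 𝔸ˣ) x κ ∈ G := fun _ _ => G.one_mem
  have h52 := pdev_one_lt (d := d) (𝔸 := 𝔸) L hL k hα
  set H := fderiv ℂ (fderiv ℂ (fun a : S → 𝔸 => CCovIter L (1 : Site d → Fin d → 𝔸ˣ) (insCfg S a) j z κ)) 0 with hH
  -- the quadratic form is twice the second-order term, hence vanishes on commuting-valued `u`
  have hQ : ∀ u : S → 𝔸, (∀ s s', Commute (u s) (u s')) → H u u = 0 := fun u hu => by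
    have h := CCovIter2_ins_eq L hL hG k 1 hU₀ hα hα3 hα4 h52 hb hsmall hc₃ S hj z κ u
    rw [CCovIter2_one_ins_eq_zero hL1 S hu j z κ] at h
    have h2 : (2 : ℂ) • ((2 : ℂ)⁻¹ • H u u) = 0 := by rw [← h, smul_zero]
    rwa [smul_smul, mul_inv_cancel₀ (two_ne_zero), one_smul] at h2
  have hsymm : H w v = H v w := by
    rw [hH]; exact (snd_fderiv_CCovIter_ins_symm L hL hG k 1 hU₀ hα hα3 hα4 h52 hb hsmall hc₃ S hj z κ v w).symm
  have hsum : H (v + w) (v + w) = H v v + H v w + H w v + H w w := by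
    simp only [map_add, add_apply]; abel
  rw [hQ _ hvw, hQ _ hvv, hQ _ hww, hsymm, zero_add, add_zero] at hsum
  have h2 : (2 : ℂ) • H v w = 0 := by rw [two_smul]; exact hsum.symm
  exact (smul_eq_zero.mp h2).resolve_left two_ne_zero

include hL hG hα hα3 hα4 hb hsmall hc₃ in
/-- **THE HESSIAN VANISHES ON COMMUTING PAIRS**: if the values of `v`, of `w`, and of `v` against `w` pairwise commute, `H(v)(w) = 0`.
[cite: Balaban1985Averaging, (136)–(138) p.39] [cite: Balaban1985Variational, (56) p.286] -/
theorem snd_fderiv_CCovIter_one_ins_eq_zero_of_commute {j : ℕ} (hj : j ≤ k) (z : Site d) (κ : Fin d) (v w : S → 𝔸)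
    (hvv : ∀ s s', Commute (v s) (v s')) (hww : ∀ s s', Commute (w s) (w s')) (hvw : ∀ s s', Commute (v s) (w s')) :
    fderiv ℂ (fderiv ℂ (fun a : S → 𝔸 => CCovIter L (1 : Site d → Fin d → 𝔸ˣ) (insCfg S a) j z κ)) 0 v w = 0 :=
  snd_fderiv_CCovIter_one_ins_eq_zero L hL hG k hα hα3 hα4 hb hsmall hc₃ S hj z κ v w hvv hww fun s s' =>
    ((hvv s s').add_right (hvw s s')).add_left ((hvw s' s).symm.add_right (hww s s'))

include hL hG hα hα3 hα4 hb hsmall hc₃ in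
/-- **THE BOND-PAIR BLOCKS OF THE HESSIAN VANISH ON COMMUTING PAIRS**: for bonds `s, s′ ∈ S` and `X, Y ∈ 𝔸` with `XY = YX`,
`H(X·e_s)(Y·e_{s′}) = 0` — Bałaban's second-order term (136) at the flat background sees a pair of bonds only through their NON-COMMUTATIVITY
(on `M_N(ℂ)` such a bilinear map factors through `[X, Y]`: `M_N` is zero-Lie-product determined, Brešar–Grašič–Sánchez Ortega, LAA 430 (2009);
Brešar, *Zero Product Determined Algebras* (2021) Thm 3.10∕Cor. 3.11 — literature, not formalised). [cite: Balaban1985Averaging, (136)–(138) p.39] [cite: Balaban1985Variational, (56) p.286] -/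
theorem snd_fderiv_CCovIter_one_single_eq_zero {j : ℕ} (hj : j ≤ k) (z : Site d) (κ : Fin d) (s s' : S) {X Y : 𝔸}
    (hXY : Commute X Y) :
    fderiv ℂ (fderiv ℂ (fun a : S → 𝔸 => CCovIter L (1 : Site d → Fin d → 𝔸ˣ) (insCfg S a) j z κ)) 0
      (Pi.single s X) (Pi.single s' Y) = 0 := by
  classical
  have key : ∀ {X' Y' : 𝔸}, Commute X' Y' → ∀ (u u' : S) (t t' : S),
      Commute ((Pi.single u X' : S → 𝔸) t) ((Pi.single u' Y' : S → 𝔸) t') := fun {X' Y'} h u u' t t' => by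
    by_cases h1 : t = u
    · subst h1
      by_cases h2 : t' = u'
      · subst h2; simpa using h
      · simp [h2]
    · simp [h1]
  exact snd_fderiv_CCovIter_one_ins_eq_zero_of_commute L hL hG k hα hα3 hα4 hb hsmall hc₃ S hj z κ _ _ (key (Commute.refl X) s s)
    (key (Commute.refl Y) s' s') (key hXY s s')

include hL hG hα hα3 hα4 hb hsmall hc₃ in
/-- **NO SAME-BOND BLOCK AT ALL**: for ONE bond `s ∈ S` and ARBITRARY `X, Y ∈ 𝔸` (commuting or not), `H(X·e_s)(Y·e_s) = 0` — the single-bond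
fields `Xe_s`, `Ye_s`, `(X+Y)e_s` all have commuting values `{·, 0}`, so the polarization applies with no hypothesis on `[X, Y]`: the second-order
term (136) at the flat background is PURELY CROSS-BOND. [cite: Balaban1985Averaging, (136)–(138) p.39] [cite: Balaban1985Variational, (56) p.286] -/
theorem snd_fderiv_CCovIter_one_single_same_eq_zero {j : ℕ} (hj : j ≤ k) (z : Site d) (κ : Fin d) (s : S) (X Y : 𝔸) :
    fderiv ℂ (fderiv ℂ (fun a : S → 𝔸 => CCovIter L (1 : Site d → Fin d → 𝔸ˣ) (insCfg S a) j z κ)) 0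
      (Pi.single s X) (Pi.single s Y) = 0 := by
  classical
  have key : ∀ (Z : 𝔸) (t t' : S), Commute ((Pi.single s Z : S → 𝔸) t) ((Pi.single s Z : S → 𝔸) t') := fun Z t t' => by
    by_cases h1 : t = s
    · subst h1
      by_cases h2 : t' = t
      · subst h2; simp
      · simp [h2]
    · simp [h1]
  refine snd_fderiv_CCovIter_one_ins_eq_zero L hL hG k hα hα3 hα4 hb hsmall hc₃ S hj z κ _ _ (key X) (key Y) fun t t' => ?_
  rw [← Pi.single_add]
  exact key (X + Y) t t'

include hL hG hα hα3 hα4 hb hsmall hc₃ in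
/-- **THE SECOND-ORDER TERM (136) AT THE FLAT BACKGROUND IS A SUM OVER PAIRS OF DISTINCT BONDS**: for every finitely supported field,
`C_j⁽²⁾(1, ins_S a)(c) = ½ Σ_s Σ_{s′ ≠ s} H(a_s·e_s)(a_{s′}·e_{s′})` — the bilinear expansion of `½H(a)(a)` over `a = Σ_s a_s e_s` with the
same-bond blocks dropped (they vanish identically); each remaining block vanishes when `a_s a_{s′} = a_{s′} a_s`. [cite: Balaban1985Averaging, (136)–(138) p.39] [cite: Balaban1985Variational, (56) p.286] -/
theorem CCovIter2_one_ins_eq_sum_offDiag {j : ℕ} (hj : j ≤ k) (z : Site d) (κ : Fin d) (a : S → 𝔸) :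
    CCovIter2 L (1 : Site d → Fin d → 𝔸ˣ) (insCfg S a) j z κ =
      (2 : ℂ)⁻¹ • ∑ s, ∑ s' ∈ Finset.univ.erase s,
        fderiv ℂ (fderiv ℂ (fun a' : S → 𝔸 => CCovIter L (1 : Site d → Fin d → 𝔸ˣ) (insCfg S a') j z κ)) 0
          (Pi.single s (a s)) (Pi.single s' (a s')) := by
  classical
  have hU₀ : ∀ (x : Site d) (κ : Fin d), (1 : Site d → Fin d → 𝔸ˣ) x κ ∈ G := fun _ _ => G.one_mem
  have h52 := pdev_one_lt (d := d) (𝔸 := 𝔸) L hL k hα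
  set H := fderiv ℂ (fderiv ℂ (fun a' : S → 𝔸 => CCovIter L (1 : Site d → Fin d → 𝔸ˣ) (insCfg S a') j z κ)) 0 with hH
  rw [CCovIter2_ins_eq L hL hG k 1 hU₀ hα hα3 hα4 h52 hb hsmall hc₃ S hj z κ a]
  congr 1
  -- expand `H a a` over `a = Σ_s a_s e_s`
  have ha : a = ∑ s, (Pi.single s (a s) : S → 𝔸) := (Finset.univ_sum_single a).symm
  have hHa : H a = ∑ s, H (Pi.single s (a s)) := by
    conv_lhs => rw [ha]
    rw [map_sum]
  have hrow : ∀ v : S → 𝔸, H v a = ∑ s', H v (Pi.single s' (a s')) := fun v => by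
    conv_lhs => rw [ha]
    rw [map_sum]
  rw [hHa, _root_.sum_apply]
  refine Finset.sum_congr rfl fun s _ => ?_
  rw [hrow, ← Finset.add_sum_erase _ _ (Finset.mem_univ s),
    snd_fderiv_CCovIter_one_single_same_eq_zero L hL hG k hα hα3 hα4 hb hsmall hc₃ S hj z κ s (a s) (a s), zero_add]

end Regime

end Summit.QuantumFields.BalabanUV.T4Continuum.NE1p.B7AveragingAbelianSector

end
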